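import Summits.RiemannHypothesis.RiemannHypothesis.Theorems.SoloInformedOfflineExcess

/-!
# The squeeze lives on the diagonal, IV: multiplicity-capped Künneth towers (solo-informed, T55d)

T54 typed Deligne's squeeze for `ζ` as the tower of full Künneth levels (all `k`-tuples of zeros,
loss `C` uniform in `k`) and T55a–c showed that the tower restricted to pairwise-DISTINCT tuples is
exactly finite total off-line excess `ExcessLeOn N C`, separated from RH.  This file interpolates:
cap the MULTIPLICITY with which one zero may occur in a tuple by `m` (the "partial diagonals of
depth `m`" inside `H¹(X)^{⊗k} ⊂ H^k(X^k)`).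

* `MultKunnethLevelOn N m k C`: a carrier in `Re s ≤ k/2 + C` contains every sum of a `k`-tuple
  from `N` in which each value occurs at most `m` times (`tupleMult ρ z ≤ m`).
* CARRIER ELIMINATION `multKunnethLevelOn_iff`, and the dictionary with T54/T55a:
  `MultKunnethLevelOn N 1 k C ↔ DistinctKunnethLevelOn N k C` (cap 1 = distinct tuples) and
  `MultKunnethLevelOn N k k C ↔ KunnethLevelOn N k C` (cap `k` on `k`-tuples = no cap).
* **`multKunnethTowerOn_iff_excessLeOn` (`1 ≤ m`): `(∀ k, MultKunnethLevelOn N m k C) ↔ ExcessLeOn N (C / m)`.**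
  The depth-`m` tower with loss `C` is worth EXACTLY total excess `C/m` — (⟸) group a tuple by its
  values, each weighted by its multiplicity `≤ m`; (⟹) test against the tuple repeating each point of
  a finite positive-excess set `m` times.
* Hence the squeeze `(∀ m ≥ 1, ∀ k, MultKunnethLevelOn N m k C) → ∀ ρ ∈ N, Re ρ ≤ 1/2`
  (`re_le_half_of_multKunnethTowerOn`, Archimedes in `m`), and for `ζ`:
  `(∀ k, MultKunnethLevel m k C) ↔ OfflineExcessLe (C / m)`,
  `RiemannHypothesis ↔ ∀ m ≥ 1, ∀ k, MultKunnethLevel m k C` for every fixed `C ≥ 0`.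

READING.  With a `k`-uniform loss, Deligne's `k → ∞` squeeze over a zero set with `b₁ = ∞` is a
squeeze in the MULTIPLICITY parameter `m`, not in the number of factors: depth `m` buys excess `C/m`
and nothing else, the distinct part (`m = 1`) buys excess `C`, and RH is `m = ∞`, i.e. the power
operation `ρ ↦ mρ` on ONE eigenclass with bounded loss — the `Sym^m`/Ramanujan squeeze of F20 with
the Satake parameter replaced by the zero (sharpest §2g (vi′)–(viii)).
-/

noncomputable section

open Complex Set Finset Literature.NumberTheory.LFunctions
open Literature.NumberTheory.LFunctions.ZetaZeros
open scoped ComplexConjugate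

namespace Summit.RiemannHypothesis.RiemannHypothesis.Theorems

variable {N : Set ℂ} {m k : ℕ} {C : ℝ}

/-- The multiplicity of the value `z` in the tuple `ρ`. [folklore] -/
def tupleMult (ρ : Fin k → ℂ) (z : ℂ) : ℕ := (Finset.univ.filter fun i ↦ ρ i = z).card

/-- **Künneth level `k` with multiplicity cap `m` and barrier `C` over `N`.** [folklore] -/
def MultKunnethLevelOn (N : Set ℂ) (m k : ℕ) (C : ℝ) : Prop :=
  ∃ Z : Set ℂ, (∀ z ∈ Z, z.re ≤ k / 2 + C) ∧
    ∀ ρ : Fin k → ℂ, (∀ z, tupleMult ρ z ≤ m) → (∀ i, ρ i ∈ N) → ∑ i, ρ i ∈ Z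

/-- For `ζ`: `MultKunnethLevel m k C := MultKunnethLevelOn NTZ m k C`. [folklore] -/
def MultKunnethLevel (m k : ℕ) (C : ℝ) : Prop :=
  MultKunnethLevelOn riemannZetaNontrivialZeros m k C

/-! ## Multiplicity bookkeeping -/

/-- A tuple is injective iff every value has multiplicity `≤ 1`. [folklore] -/
theorem injective_iff_tupleMult_le_one {ρ : Fin k → ℂ} :
    Function.Injective ρ ↔ ∀ z, tupleMult ρ z ≤ 1 := by
  classical
  constructor
  · intro hρ z
    exact Finset.card_le_one.2 fun a ha b hb ↦
      hρ ((Finset.mem_filter.1 ha).2.trans (Finset.mem_filter.1 hb).2.symm)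
  · intro h a b hab
    have ha : a ∈ Finset.univ.filter fun i ↦ ρ i = ρ b := Finset.mem_filter.2 ⟨Finset.mem_univ _, hab⟩
    have hb : b ∈ Finset.univ.filter fun i ↦ ρ i = ρ b := Finset.mem_filter.2 ⟨Finset.mem_univ _, rfl⟩
    exact Finset.card_le_one.1 (h (ρ b)) a ha b hb

/-- Every multiplicity in a `k`-tuple is `≤ k`. [folklore] -/
theorem tupleMult_le (ρ : Fin k → ℂ) (z : ℂ) : tupleMult ρ z ≤ k := by
  classical
  calc tupleMult ρ z ≤ (Finset.univ : Finset (Fin k)).card := Finset.card_filter_le _ _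
    _ = k := by rw [Finset.card_univ, Fintype.card_fin]

/-- Grouping a tuple sum by values: `∑_i f(ρ_i) = ∑_{z ∈ image} (mult z) · f z`. [folklore] -/
theorem sum_tuple_eq_sum_image_mul (ρ : Fin k → ℂ) (f : ℂ → ℝ) :
    ∑ i, f (ρ i) = ∑ z ∈ Finset.univ.image ρ, (tupleMult ρ z : ℝ) * f z := by
  classical
  rw [← Finset.sum_fiberwise_of_maps_to (s := Finset.univ) (t := Finset.univ.image ρ) (g := ρ)
    (fun i hi ↦ Finset.mem_image_of_mem ρ hi) (f := fun i ↦ f (ρ i))]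
  refine Finset.sum_congr rfl fun z _ ↦ ?_
  rw [Finset.sum_congr rfl fun i hi ↦ (by rw [(Finset.mem_filter.1 hi).2] : f (ρ i) = f z),
    Finset.sum_const, nsmul_eq_mul]
  rfl

/-! ## Carrier elimination and the dictionary with T54 / T55a -/

/-- Carrier elimination: the level says `∑_i Re ρ_i ≤ k/2 + C` for every admissible tuple. [folklore] -/
theorem multKunnethLevelOn_iff :
    MultKunnethLevelOn N m k C ↔
      ∀ ρ : Fin k → ℂ, (∀ z, tupleMult ρ z ≤ m) → (∀ i, ρ i ∈ N) → ∑ i, (ρ i).re ≤ k / 2 + C := by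
  constructor
  · rintro ⟨Z, hZ, hK⟩ ρ hm hρ
    have h := hZ _ (hK ρ hm hρ)
    rwa [re_sum] at h
  · intro h
    refine ⟨{z | z.re ≤ k / 2 + C}, fun z hz ↦ hz, fun ρ hm hρ ↦ ?_⟩
    show (∑ i, ρ i).re ≤ k / 2 + C
    rw [re_sum]
    exact h ρ hm hρ

/-- Cap `1` = pairwise-distinct tuples (T55a). [folklore] -/
theorem multKunnethLevelOn_one_iff : MultKunnethLevelOn N 1 k C ↔ DistinctKunnethLevelOn N k C := by
  constructor
  · rintro ⟨Z, hZ, hK⟩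
    exact ⟨Z, hZ, fun ρ hinj hρ ↦ hK ρ (injective_iff_tupleMult_le_one.1 hinj) hρ⟩
  · rintro ⟨Z, hZ, hK⟩
    exact ⟨Z, hZ, fun ρ hm hρ ↦ hK ρ (injective_iff_tupleMult_le_one.2 hm) hρ⟩

/-- Cap `k` on `k`-tuples = no cap (T54's full level). [folklore] -/
theorem multKunnethLevelOn_self_iff : MultKunnethLevelOn N k k C ↔ KunnethLevelOn N k C := by
  constructor
  · rintro ⟨Z, hZ, hK⟩
    exact ⟨Z, hZ, fun ρ hρ ↦ hK ρ (tupleMult_le ρ) hρ⟩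
  · rintro ⟨Z, hZ, hK⟩
    exact ⟨Z, hZ, fun ρ _ hρ ↦ hK ρ hρ⟩

/-- Monotonicity in the cap: a larger cap is a stronger level. [folklore] -/
theorem MultKunnethLevelOn.of_le {m' : ℕ} (h : MultKunnethLevelOn N m' k C) (hm : m ≤ m') :
    MultKunnethLevelOn N m k C := by
  obtain ⟨Z, hZ, hK⟩ := h
  exact ⟨Z, hZ, fun ρ hρm hρ ↦ hK ρ (fun z ↦ (hρm z).trans hm) hρ⟩

/-! ## The depth-`m` tower is worth exactly excess `C/m` -/

/-- Positive parts over a finite subset of `N` are bounded by the excess bound. [folklore] -/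
theorem ExcessLeOn.sum_pos_part_le' (h : ExcessLeOn N C) {S : Finset ℂ} (hS : (↑S : Set ℂ) ⊆ N) :
    ∑ z ∈ S, max (z.re - 1 / 2) 0 ≤ C := by
  classical
  rw [← Finset.sum_filter_add_sum_filter_not S (fun z ↦ 1 / 2 < z.re)]
  have h1 : ∑ z ∈ S.filter (fun z ↦ 1 / 2 < z.re), max (z.re - 1 / 2) 0
      = ∑ z ∈ S.filter (fun z ↦ 1 / 2 < z.re), (z.re - 1 / 2) :=
    Finset.sum_congr rfl fun z hz ↦ max_eq_left (by have := (Finset.mem_filter.1 hz).2; linarith)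
  have h2 : ∑ z ∈ S.filter (fun z ↦ ¬ 1 / 2 < z.re), max (z.re - 1 / 2) 0 = 0 :=
    Finset.sum_eq_zero fun z hz ↦ max_eq_right (by
      have := (Finset.mem_filter.1 hz).2; rw [not_lt] at this; linarith)
  rw [h1, h2, add_zero]
  exact h _ fun z hz ↦ hS (Finset.mem_coe.2 (Finset.mem_filter.1 (Finset.mem_coe.1 hz)).1)

/-- (⟸) Excess `C/m` gives every depth-`m` level with loss `C`. [folklore] -/
theorem ExcessLeOn.multKunnethLevelOn (hm : 1 ≤ m) (h : ExcessLeOn N (C / m)) (k : ℕ) :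
    MultKunnethLevelOn N m k C := by
  classical
  have hm0 : (0 : ℝ) < m := by exact_mod_cast hm
  rw [multKunnethLevelOn_iff]
  intro ρ hρm hρ
  have hsub : (↑(Finset.univ.image ρ) : Set ℂ) ⊆ N := by
    intro z hz
    rw [Finset.coe_image] at hz
    obtain ⟨i, -, rfl⟩ := hz
    exact hρ i
  -- ∑ Re ρ_i - k/2 = ∑_i (Re ρ_i - 1/2) = ∑_{z ∈ image} mult z * (Re z - 1/2)
  have hk : ∑ i : Fin k, ((ρ i).re - 1 / 2) = ∑ i, (ρ i).re - k / 2 := by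
    rw [Finset.sum_sub_distrib, Finset.sum_const, Finset.card_univ, Fintype.card_fin, nsmul_eq_mul]
    ring
  have hgroup := sum_tuple_eq_sum_image_mul ρ (fun z ↦ z.re - 1 / 2)
  -- termwise: mult z * (Re z - 1/2) ≤ m * max (Re z - 1/2) 0
  have hterm : ∀ z ∈ Finset.univ.image ρ,
      (tupleMult ρ z : ℝ) * (z.re - 1 / 2) ≤ (m : ℝ) * max (z.re - 1 / 2) 0 := by
    intro z _
    have hmz : (tupleMult ρ z : ℝ) ≤ m := by exact_mod_cast hρm z
    have hmz0 : (0 : ℝ) ≤ tupleMult ρ z := by positivity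
    rcases le_or_gt 0 (z.re - 1 / 2) with hpos | hneg
    · rw [max_eq_left hpos]
      exact mul_le_mul_of_nonneg_right hmz hpos
    · rw [max_eq_right hneg.le, mul_zero]
      exact mul_nonpos_of_nonneg_of_nonpos hmz0 hneg.le
  have hpos := h.sum_pos_part_le' hsub
  have hchain : ∑ i : Fin k, ((ρ i).re - 1 / 2) ≤ C := by
    calc ∑ i : Fin k, ((ρ i).re - 1 / 2)
        = ∑ z ∈ Finset.univ.image ρ, (tupleMult ρ z : ℝ) * (z.re - 1 / 2) := hgroup
      _ ≤ ∑ z ∈ Finset.univ.image ρ, (m : ℝ) * max (z.re - 1 / 2) 0 := Finset.sum_le_sum hterm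
      _ = (m : ℝ) * ∑ z ∈ Finset.univ.image ρ, max (z.re - 1 / 2) 0 := by rw [Finset.mul_sum]
      _ ≤ (m : ℝ) * (C / m) := mul_le_mul_of_nonneg_left hpos hm0.le
      _ = C := by field_simp
  linarith

/-- (⟹) The depth-`m` tower with loss `C` forces excess `≤ C/m`: test against the tuple repeating
each point of a finite set of points right of the line `m` times. [folklore] -/
theorem excessLeOn_of_multKunnethTowerOn (hm : 1 ≤ m) (h : ∀ k, MultKunnethLevelOn N m k C) :
    ExcessLeOn N (C / m) := by
  classical
  have hm0 : (0 : ℝ) < m := by exact_mod_cast hm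
  intro S hS
  -- reduce to the points strictly right of the line
  set P := S.filter (fun z ↦ 1 / 2 < z.re) with hP
  have hSP : ∑ z ∈ S, (z.re - 1 / 2) ≤ ∑ z ∈ P, (z.re - 1 / 2) := by
    rw [← Finset.sum_filter_add_sum_filter_not S (fun z ↦ 1 / 2 < z.re)]
    have : ∑ z ∈ S.filter (fun z ↦ ¬ 1 / 2 < z.re), (z.re - 1 / 2) ≤ 0 :=
      Finset.sum_nonpos fun z hz ↦ by
        have := (Finset.mem_filter.1 hz).2; rw [not_lt] at this; linarith
    linarith
  have hPN : ∀ z ∈ P, z ∈ N := fun z hz ↦ hS (Finset.mem_coe.2 (Finset.mem_filter.1 hz).1)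
  -- the test tuple: each point of P repeated m times
  set n := P.card with hn
  let e : Fin n ≃ ↥P := P.equivFin.symm
  let ρ : Fin (n * m) → ℂ := fun i ↦ ((e (finProdFinEquiv.symm i).1 : ↥P) : ℂ)
  have hρN : ∀ i, ρ i ∈ N := fun i ↦ hPN _ (e (finProdFinEquiv.symm i).1).2
  have hρm : ∀ z, tupleMult ρ z ≤ m := by
    intro z
    -- the second coordinate is injective on the fibre over z
    have hinj : Set.InjOn (fun i : Fin (n * m) ↦ (finProdFinEquiv.symm i).2)
        ↑(Finset.univ.filter fun i ↦ ρ i = z) := by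
      intro i hi j hj hij
      have hi' : ρ i = z := (Finset.mem_filter.1 (Finset.mem_coe.1 hi)).2
      have hj' : ρ j = z := (Finset.mem_filter.1 (Finset.mem_coe.1 hj)).2
      have h1 : (finProdFinEquiv.symm i).1 = (finProdFinEquiv.symm j).1 :=
        e.injective (Subtype.ext (hi'.trans hj'.symm))
      exact finProdFinEquiv.symm.injective (Prod.ext h1 hij)
    calc tupleMult ρ z ≤ (Finset.univ : Finset (Fin m)).card :=
          Finset.card_le_card_of_injOn _ (fun i _ ↦ Finset.mem_coe.2 (Finset.mem_univ _)) hinj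
      _ = m := by rw [Finset.card_univ, Fintype.card_fin]
  have hlevel := (multKunnethLevelOn_iff.1 (h (n * m))) ρ hρm hρN
  -- evaluate the tuple sum: ∑_i Re ρ_i = m * ∑_{z ∈ P} Re z
  have hsum : ∑ i, (ρ i).re = (m : ℝ) * ∑ z ∈ P, z.re := by
    have h1 : ∑ i, (ρ i).re = ∑ p : Fin n × Fin m, ((e p.1 : ↥P) : ℂ).re :=
      (Equiv.sum_comp finProdFinEquiv.symm (fun p : Fin n × Fin m ↦ ((e p.1 : ↥P) : ℂ).re))
    rw [h1, Fintype.sum_prod_type]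
    simp only [Finset.sum_const, Finset.card_univ, Fintype.card_fin, nsmul_eq_mul]
    rw [← Finset.mul_sum, Equiv.sum_comp e (fun x : ↥P ↦ (x : ℂ).re), Finset.sum_coe_sort P (fun z ↦ z.re)]
  have hcast : ((n * m : ℕ) : ℝ) = (n : ℝ) * m := by push_cast; ring
  rw [hsum, hcast] at hlevel
  -- conclude: m * ∑_P (Re z - 1/2) ≤ C
  have hPsum : ∑ z ∈ P, (z.re - 1 / 2) = ∑ z ∈ P, z.re - n / 2 := by
    rw [Finset.sum_sub_distrib, Finset.sum_const, ← hn, nsmul_eq_mul]; ring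
  have hmain : (m : ℝ) * ∑ z ∈ P, (z.re - 1 / 2) ≤ C := by rw [hPsum]; nlinarith
  calc ∑ z ∈ S, (z.re - 1 / 2) ≤ ∑ z ∈ P, (z.re - 1 / 2) := hSP
    _ ≤ C / m := by rw [le_div_iff₀ hm0, mul_comm]; exact hmain

/-- **The depth-`m` Künneth tower with loss `C` is worth exactly total excess `C/m`.** [folklore] -/
theorem multKunnethTowerOn_iff_excessLeOn (hm : 1 ≤ m) :
    (∀ k, MultKunnethLevelOn N m k C) ↔ ExcessLeOn N (C / m) :=
  ⟨excessLeOn_of_multKunnethTowerOn hm, fun h k ↦ h.multKunnethLevelOn hm k⟩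

/-- The squeeze in the multiplicity parameter: all depths with one loss `C` force `Re ≤ 1/2` on `N`
(excess `C/m` for every `m`, Archimedes). [folklore] -/
theorem re_le_half_of_multKunnethTowerOn (h : ∀ m : ℕ, 1 ≤ m → ∀ k, MultKunnethLevelOn N m k C)
    {ρ : ℂ} (hρ : ρ ∈ N) : ρ.re ≤ 1 / 2 := by
  have key : ∀ m : ℕ, 1 ≤ m → (m : ℝ) * (ρ.re - 1 / 2) ≤ C := by
    intro m hm
    have hm0 : (0 : ℝ) < m := by exact_mod_cast hm
    have hex := (excessLeOn_of_multKunnethTowerOn hm (h m hm)).re_le hρ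
    have : ρ.re - 1 / 2 ≤ C / m := by linarith
    rwa [le_div_iff₀ hm0, mul_comm] at this
  linarith [nonpos_of_forall_nat_mul_le key]

/-! ## For `ζ` -/

/-- For `ζ`: the depth-`m` tower with loss `C` is exactly off-line excess `≤ C/m`. [folklore] -/
theorem multKunnethTower_iff_offlineExcessLe (hm : 1 ≤ m) :
    (∀ k, MultKunnethLevel m k C) ↔ OfflineExcessLe (C / m) :=
  multKunnethTowerOn_iff_excessLeOn hm

/-- **RH is the `m → ∞` end of the multiplicity squeeze, for any fixed loss `C ≥ 0`.** [folklore] -/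
theorem riemannHypothesis_iff_multKunnethTower (hC : 0 ≤ C) :
    RiemannHypothesis ↔ ∀ m : ℕ, 1 ≤ m → ∀ k, MultKunnethLevel m k C := by
  constructor
  · intro hRH m hm k
    have h0 := offlineExcessLe_of_riemannHypothesis hRH
    have hm0 : (0 : ℝ) < m := by exact_mod_cast hm
    exact (ExcessLeOn.mono h0 (div_nonneg hC hm0.le)).multKunnethLevelOn hm k
  · intro h
    refine riemannHypothesis_of_offlineExcessLe_zero fun S hS ↦ ?_
    have hle : ∀ z ∈ S, z.re - 1 / 2 ≤ 0 := fun z hz ↦ by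
      linarith [re_le_half_of_multKunnethTowerOn h (hS (Finset.mem_coe.2 hz))]
    exact Finset.sum_nonpos hle

end Summit.RiemannHypothesis.RiemannHypothesis.Theorems

end
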